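import Mathlib
import HarnessLib
import Literature.Probability.RandomPlanarGeometry.NestingTransform
import Summits.CriticalPhenomena.CardyFormulaZ2.Theorems.CardyMagicRigidityMagicFormulaTCountRepresentation3
import Summits.CriticalPhenomena.CardyFormulaZ2.Theorems.CardyMagicRigidityMagicFormulaTCountRepresentation4b

/-!
# Line `Sketch` for crux `MagicFormulaT`, sub-goal `cr4a_expect_powerSums_eq_counts`:
# the count representation of the four-point power-sum statistics at fixed mesh, part (a)

Crux `Summit.CriticalPhenomena.CardyFormulaZ2.Theses.CardyMagicRigidity.MagicFormulaT`
(stmt-CriticalPhenomena-4836), line `Sketch`: part (a) of the order-4 analogue of the landed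
bridges `cr_expect_powerSums_eq_counts` (order 2) and `cr3_expect_powerSums_eq_counts` (order 3).
With `θ_u = u.nestingPhase f = ∫_{W(u,·) ≠ 0} f` over the interface loops `u` of
`siteLoopConfig δ ω` under `triSitePercolation half`, an admissible density `f` and a mesh
`δ > 0`: `E[Σ_u θ_u⁴] = ∫⁴ f⊗⁴ E[N(x ∧ y ∧ z ∧ w)]`,
`E[(Σ_u θ_u)(Σ_u θ_u³)] = ∫⁴ f⊗⁴ E[N(x) N(y ∧ z ∧ w)]` and
`E[(Σ_u θ_u²)²] = ∫⁴ f⊗⁴ E[N(x ∧ y) N(z ∧ w)]`, where `N(x ∧ …)` counts the loops winding around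
all the listed points and meeting `B̄(0, R)`.  §1 is the PATHWISE identity (`cr4a_pathwise`,
honest finite sums over the loops meeting the ball, reusing `cr_pathwise` / `cr3_pathwise`), §2
the registered sub-goal: Fubini for a bounded jointly measurable four-point kernel is the landed
sibling lemma `cr4b_integral_swap`, the counts being bounded by the deterministic number of loops
meeting the ball (`ncard_loops_siteLoopConfig_meeting_le`) and jointly measurable
(`cr_measurable_ncard_loops`).  Tree / Mathlib material only; no named fact; no definition.
-/

noncomputable section

namespace Summit.CriticalPhenomena.CardyFormulaZ2.Cruxes.MagicFormulaT.LineSketch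

open MeasureTheory Filter Set Metric
open scoped Real Topology BigOperators ENNReal
open Literature.Probability.RandomPlanarGeometry Literature.Probability.Percolation
  Literature.Probability.LatticeModels

/-! ## §1 The pathwise four-point count representation, part (a) -/

/-- Pointwise equal integrands have equal fourfold iterated integrals. -/
theorem cr4a_integral4_congr {F G : ℂ → ℂ → ℂ → ℂ → ℝ} (h : ∀ x y z w, F x y z w = G x y z w) :
    ∫ x, ∫ y, ∫ z, ∫ w, F x y z w = ∫ x, ∫ y, ∫ z, ∫ w, G x y z w := by
  simp only [h]

/-- **Pathwise four-point count representation, part (a).**  For an admissible density `f` and a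
loop family `L` with finitely many loops meeting `B̄(0, R)`, with
`N(x) = #{u ∈ L : W(u,x) ≠ 0, u meets B̄(0,R)}` and its multi-point analogues:
`Σ_u θ_u⁴ = ∫⁴ f⊗⁴ N(x ∧ y ∧ z ∧ w)`, `(Σ_u θ_u)(Σ_u θ_u³) = ∫⁴ f⊗⁴ N(x) N(y ∧ z ∧ w)` and
`(Σ_u θ_u²)² = ∫⁴ f⊗⁴ N(x ∧ y) N(z ∧ w)` — honest finite sums over the loops meeting the ball
(`sw_meets_of_nestingPhase_ne_zero`), `θ_u = ∫ f 𝟙_{W(u,·) ≠ 0}`, finite sums exchanged with the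
integrals, and `cr_pathwise`, `cr3_pathwise` for the inner integrals. -/
theorem cr4a_pathwise {f : ℂ → ℝ} {R C : ℝ} (hf : Measurable f) (hC : ∀ z, |f z| ≤ C)
    (hR : ∀ z, R < ‖z‖ → f z = 0) (h0 : ∫ z, f z = 0) {L : Set (UnbasedLoop ℂ)}
    (hT : {u ∈ L | (u.range ∩ closedBall (0 : ℂ) R).Nonempty}.Finite) :
    (∑ᶠ u ∈ L, u.nestingPhase f ^ 4) = ∫ x, ∫ y, ∫ z, ∫ w, f x * f y * f z * f w *
        (Set.ncard {u ∈ L | u.wind x ≠ 0 ∧ u.wind y ≠ 0 ∧ u.wind z ≠ 0 ∧ u.wind w ≠ 0 ∧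
          (u.range ∩ closedBall (0 : ℂ) R).Nonempty} : ℝ) ∧
    (∑ᶠ u ∈ L, u.nestingPhase f) * (∑ᶠ u ∈ L, u.nestingPhase f ^ 3) =
      ∫ x, ∫ y, ∫ z, ∫ w, f x * f y * f z * f w *
        ((Set.ncard {u ∈ L | u.wind x ≠ 0 ∧ (u.range ∩ closedBall (0 : ℂ) R).Nonempty} : ℝ) *
          (Set.ncard {u ∈ L | u.wind y ≠ 0 ∧ u.wind z ≠ 0 ∧ u.wind w ≠ 0 ∧
            (u.range ∩ closedBall (0 : ℂ) R).Nonempty} : ℝ)) ∧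
    (∑ᶠ u ∈ L, u.nestingPhase f ^ 2) ^ 2 = ∫ x, ∫ y, ∫ z, ∫ w, f x * f y * f z * f w *
        ((Set.ncard {u ∈ L | u.wind x ≠ 0 ∧ u.wind y ≠ 0 ∧
            (u.range ∩ closedBall (0 : ℂ) R).Nonempty} : ℝ) *
          (Set.ncard {u ∈ L | u.wind z ≠ 0 ∧ u.wind w ≠ 0 ∧
            (u.range ∩ closedBall (0 : ℂ) R).Nonempty} : ℝ)) := by
  classical
  -- the finite family `S` of loops meeting the ball, and the interior indicators `g u`
  obtain ⟨S, hmemS⟩ : ∃ S : Finset (UnbasedLoop ℂ), ∀ u, u ∈ S ↔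
      u ∈ L ∧ (u.range ∩ closedBall (0 : ℂ) R).Nonempty :=
    ⟨hT.toFinset, fun u ↦ by rw [Set.Finite.mem_toFinset, Set.mem_setOf_eq]⟩
  obtain ⟨g, hg⟩ : ∃ g : UnbasedLoop ℂ → ℂ → ℝ, ∀ u, g u = {z | u.wind z ≠ 0}.indicator f :=
    ⟨_, fun _ ↦ rfl⟩
  have hfi : Integrable f volume := integrable_of_abs_le_of_eq_zero hf hC hR
  have hgi : ∀ u, Integrable (g u) volume := fun u ↦ by
    rw [hg]
    exact hfi.indicator (measurableSet_setOf_wind_ne_zero u)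
  have hθ : ∀ u : UnbasedLoop ℂ, u.nestingPhase f = ∫ x, g u x := fun u ↦ by
    rw [hg]
    exact (integral_indicator (measurableSet_setOf_wind_ne_zero u)).symm
  have hg1 : ∀ u x, u.wind x ≠ 0 → g u x = f x := fun u x hx ↦ by
    rw [hg]
    exact Set.indicator_of_mem hx f
  have hg0 : ∀ u x, ¬u.wind x ≠ 0 → g u x = 0 := fun u x hx ↦ by
    rw [hg]
    exact Set.indicator_of_notMem hx f
  -- finsums are finite sums over `S`
  have hfs : ∀ φ : ℝ → ℝ, φ 0 = 0 →
      ∑ᶠ u ∈ L, φ (u.nestingPhase f) = ∑ u ∈ S, φ (u.nestingPhase f) := by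
    intro φ hφ
    refine finsum_mem_eq_sum_of_subset _ (fun u hu ↦ ?_) (fun u hu ↦ ((hmemS u).1 hu).1)
    rw [Finset.mem_coe, hmemS]
    refine ⟨hu.1, sw_meets_of_nestingPhase_ne_zero hR h0 fun h ↦ hu.2 ?_⟩
    show φ (u.nestingPhase f) = 0
    rw [h, hφ]
  -- the one-point and four-point counts as finite sums of indicators
  have hC1 : ∀ x, ∑ u ∈ S, g u x = f x *
      (Set.ncard {u ∈ L | u.wind x ≠ 0 ∧ (u.range ∩ closedBall (0 : ℂ) R).Nonempty} : ℝ) := by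
    intro x
    rw [cr_sum_eq_card_mul S (fun u ↦ u.wind x ≠ 0) (fun u ↦ g u x) (f x)
        (fun u _ hu ↦ hg1 u x hu) (fun u _ hu ↦ hg0 u x hu),
      cr_ncard_sep_eq_card_filter hmemS _ (fun u ↦ u.wind x ≠ 0) (fun u ↦ Iff.rfl), mul_comm]
  have hC4 : ∀ x y z w, ∑ u ∈ S, g u x * g u y * g u z * g u w = f x * f y * f z * f w *
      (Set.ncard {u ∈ L | u.wind x ≠ 0 ∧ u.wind y ≠ 0 ∧ u.wind z ≠ 0 ∧ u.wind w ≠ 0 ∧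
        (u.range ∩ closedBall (0 : ℂ) R).Nonempty} : ℝ) := by
    intro x y z w
    have hq : ∀ u : UnbasedLoop ℂ, (u.wind x ≠ 0 ∧ u.wind y ≠ 0 ∧ u.wind z ≠ 0 ∧
        u.wind w ≠ 0 ∧ (u.range ∩ closedBall (0 : ℂ) R).Nonempty) ↔
        (u.wind x ≠ 0 ∧ u.wind y ≠ 0 ∧ u.wind z ≠ 0 ∧ u.wind w ≠ 0) ∧
          (u.range ∩ closedBall (0 : ℂ) R).Nonempty := fun u ↦ by
      rw [and_assoc, and_assoc, and_assoc]
    have hz : ∀ u ∈ S, ¬(u.wind x ≠ 0 ∧ u.wind y ≠ 0 ∧ u.wind z ≠ 0 ∧ u.wind w ≠ 0) →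
        g u x * g u y * g u z * g u w = 0 := by
      intro u _ hu
      obtain h | h | h | h : ¬u.wind x ≠ 0 ∨ ¬u.wind y ≠ 0 ∨ ¬u.wind z ≠ 0 ∨ ¬u.wind w ≠ 0 := by
        simpa only [not_and_or] using hu
      · rw [hg0 u x h, zero_mul, zero_mul, zero_mul]
      · rw [hg0 u y h, mul_zero, zero_mul, zero_mul]
      · rw [hg0 u z h, mul_zero, zero_mul]
      · rw [hg0 u w h, mul_zero]
    rw [cr_sum_eq_card_mul S (fun u ↦ u.wind x ≠ 0 ∧ u.wind y ≠ 0 ∧ u.wind z ≠ 0 ∧ u.wind w ≠ 0)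
        (fun u ↦ g u x * g u y * g u z * g u w) (f x * f y * f z * f w)
        (fun u _ hu ↦ by rw [hg1 u x hu.1, hg1 u y hu.2.1, hg1 u z hu.2.2.1, hg1 u w hu.2.2.2])
        hz,
      cr_ncard_sep_eq_card_filter hmemS _
        (fun u ↦ u.wind x ≠ 0 ∧ u.wind y ≠ 0 ∧ u.wind z ≠ 0 ∧ u.wind w ≠ 0) hq, mul_comm]
  -- `A₁ = ∫ f N`
  have hA1 : ∑ᶠ u ∈ L, u.nestingPhase f = ∫ x, f x *
      (Set.ncard {u ∈ L | u.wind x ≠ 0 ∧ (u.range ∩ closedBall (0 : ℂ) R).Nonempty} : ℝ) := by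
    rw [hfs (fun t ↦ t) rfl]
    calc ∑ u ∈ S, u.nestingPhase f = ∑ u ∈ S, ∫ x, g u x :=
          Finset.sum_congr rfl fun u _ ↦ hθ u
      _ = ∫ x, ∑ u ∈ S, g u x := (integral_finsetSum S fun u _ ↦ hgi u).symm
      _ = _ := integral_congr_ae (Eventually.of_forall fun x ↦ hC1 x)
  refine ⟨?_, ?_, ?_⟩
  · -- `Σ_u θ_u⁴`
    rw [hfs (fun t ↦ t ^ 4) (by norm_num)]
    calc ∑ u ∈ S, u.nestingPhase f ^ 4
        = ∑ u ∈ S, ∫ x, g u x * u.nestingPhase f ^ 3 :=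
          Finset.sum_congr rfl fun u _ ↦ by rw [integral_mul_const, ← hθ u]; ring
      _ = ∫ x, ∑ u ∈ S, g u x * u.nestingPhase f ^ 3 :=
          (integral_finsetSum S fun u _ ↦ (hgi u).mul_const _).symm
      _ = ∫ x, ∑ u ∈ S, ∫ y, g u x * g u y * u.nestingPhase f ^ 2 :=
          integral_congr_ae (Eventually.of_forall fun x ↦ Finset.sum_congr rfl fun u _ ↦ by
            rw [integral_mul_const, integral_const_mul, ← hθ u]; ring)
      _ = ∫ x, ∫ y, ∑ u ∈ S, g u x * g u y * u.nestingPhase f ^ 2 :=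
          integral_congr_ae (Eventually.of_forall fun x ↦
            (integral_finsetSum S fun u _ ↦ ((hgi u).const_mul _).mul_const _).symm)
      _ = ∫ x, ∫ y, ∑ u ∈ S, ∫ z, g u x * g u y * g u z * u.nestingPhase f :=
          integral_congr_ae (Eventually.of_forall fun x ↦ integral_congr_ae
            (Eventually.of_forall fun y ↦ Finset.sum_congr rfl fun u _ ↦ by
              rw [integral_mul_const, integral_const_mul, ← hθ u]; ring))
      _ = ∫ x, ∫ y, ∫ z, ∑ u ∈ S, g u x * g u y * g u z * u.nestingPhase f :=
          integral_congr_ae (Eventually.of_forall fun x ↦ integral_congr_ae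
            (Eventually.of_forall fun y ↦
              (integral_finsetSum S fun u _ ↦ ((hgi u).const_mul _).mul_const _).symm))
      _ = ∫ x, ∫ y, ∫ z, ∑ u ∈ S, ∫ w, g u x * g u y * g u z * g u w :=
          integral_congr_ae (Eventually.of_forall fun x ↦ integral_congr_ae
            (Eventually.of_forall fun y ↦ integral_congr_ae
              (Eventually.of_forall fun z ↦ Finset.sum_congr rfl fun u _ ↦ by
                rw [integral_const_mul, ← hθ u])))
      _ = _ :=
          integral_congr_ae (Eventually.of_forall fun x ↦ integral_congr_ae
            (Eventually.of_forall fun y ↦ integral_congr_ae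
              (Eventually.of_forall fun z ↦
                (integral_finsetSum S fun u _ ↦ (hgi u).const_mul _).symm.trans
                  (integral_congr_ae (Eventually.of_forall fun w ↦ hC4 x y z w)))))
  · -- `(Σ_u θ_u)(Σ_u θ_u³)`: push the factors inside and compare integrands
    rw [(cr3_pathwise hf hC hR h0 hT).1, hA1, ← integral_mul_const]
    simp_rw [← integral_const_mul]
    exact cr4a_integral4_congr fun x y z w ↦ by ring
  · -- `(Σ_u θ_u²)²`: push the factors inside and compare integrands
    rw [(cr_pathwise hf hC hR h0 hT).1, sq, ← integral_mul_const]
    simp_rw [← integral_mul_const, ← integral_const_mul]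
    exact cr4a_integral4_congr fun x y z w ↦ by ring

/-! ## §2 The registered sub-goal -/

/-- **Sub-goal `cr4a_expect_powerSums_eq_counts` · count representation of the four-point
power-sum statistics at fixed mesh, part (a).**  For an admissible density `f` (measurable,
`|f| ≤ C`, `f = 0` off `B̄(0, R)`, `∫ f = 0`) and a mesh `δ > 0`, with `θ_u = ∫_{W(u,·) ≠ 0} f`
over the interface loops of `siteLoopConfig δ ω` under `triSitePercolation half`,
`N(x) = #{u : W(u,x) ≠ 0, u meets B̄(0,R)}` and its multi-point analogues `N(x ∧ y)`,
`N(y ∧ z ∧ w)`, `N(x ∧ y ∧ z ∧ w)` (loops winding around all the listed points and meeting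
`B̄(0,R)`): `E[Σ_u θ_u⁴] = ∫⁴ f⊗⁴ E[N(x ∧ y ∧ z ∧ w)]`,
`E[(Σ_u θ_u)(Σ_u θ_u³)] = ∫⁴ f⊗⁴ E[N(x) N(y ∧ z ∧ w)]` and
`E[(Σ_u θ_u²)²] = ∫⁴ f⊗⁴ E[N(x ∧ y) N(z ∧ w)]`.  Pathwise (`cr4a_pathwise`) only the finitely
many loops meeting `B̄(0, R)` contribute (`ncard_loops_siteLoopConfig_meeting_le`); then Fubini
(`cr4b_integral_swap`): the counts are bounded by the deterministic number of loops meeting the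
ball and jointly measurable (`cr_measurable_ncard_loops`). -/
theorem cr4a_expect_powerSums_eq_counts : ∀ (f : ℂ → ℝ) (R C : ℝ), Measurable f → (∀ z, |f z| ≤ C) →
    (∀ z, R < ‖z‖ → f z = 0) → ∫ z, f z = 0 → ∀ δ : ℝ, 0 < δ →
    (∫ ω, (∑ᶠ u ∈ (siteLoopConfig δ ω).loops, u.nestingPhase f ^ 4) ∂(triSitePercolation half) =
      ∫ x, ∫ y, ∫ z, ∫ w, f x * f y * f z * f w * ∫ ω, (Set.ncard {u ∈ (siteLoopConfig δ ω).loops | u.wind x ≠ 0 ∧ u.wind y ≠ 0 ∧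
        u.wind z ≠ 0 ∧ u.wind w ≠ 0 ∧ (u.range ∩ Metric.closedBall (0 : ℂ) R).Nonempty} : ℝ) ∂(triSitePercolation half)) ∧
    (∫ ω, (∑ᶠ u ∈ (siteLoopConfig δ ω).loops, u.nestingPhase f) *
        (∑ᶠ u ∈ (siteLoopConfig δ ω).loops, u.nestingPhase f ^ 3) ∂(triSitePercolation half) =
      ∫ x, ∫ y, ∫ z, ∫ w, f x * f y * f z * f w * ∫ ω, ((Set.ncard {u ∈ (siteLoopConfig δ ω).loops | u.wind x ≠ 0 ∧
        (u.range ∩ Metric.closedBall (0 : ℂ) R).Nonempty} : ℝ) *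
        (Set.ncard {u ∈ (siteLoopConfig δ ω).loops | u.wind y ≠ 0 ∧ u.wind z ≠ 0 ∧ u.wind w ≠ 0 ∧
        (u.range ∩ Metric.closedBall (0 : ℂ) R).Nonempty} : ℝ)) ∂(triSitePercolation half)) ∧
    (∫ ω, (∑ᶠ u ∈ (siteLoopConfig δ ω).loops, u.nestingPhase f ^ 2) ^ 2 ∂(triSitePercolation half) =
      ∫ x, ∫ y, ∫ z, ∫ w, f x * f y * f z * f w * ∫ ω, ((Set.ncard {u ∈ (siteLoopConfig δ ω).loops | u.wind x ≠ 0 ∧ u.wind y ≠ 0 ∧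
        (u.range ∩ Metric.closedBall (0 : ℂ) R).Nonempty} : ℝ) *
        (Set.ncard {u ∈ (siteLoopConfig δ ω).loops | u.wind z ≠ 0 ∧ u.wind w ≠ 0 ∧
        (u.range ∩ Metric.closedBall (0 : ℂ) R).Nonempty} : ℝ)) ∂(triSitePercolation half)) := by
  intro f R C hf hC hR h0 δ hδ
  have hfi : Integrable f volume := integrable_of_abs_le_of_eq_zero hf hC hR
  -- finiteness and the deterministic bound on the loops meeting the ball
  have hT : ∀ ω : SiteConfig (Site 2),
      {u ∈ (siteLoopConfig δ ω).loops | (u.range ∩ closedBall (0 : ℂ) R).Nonempty}.Finite :=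
    fun ω ↦ (ncard_loops_siteLoopConfig_meeting_le hδ R ω).1
  obtain ⟨Nmax, hNmax⟩ : ∃ N : ℕ, ∀ ω : SiteConfig (Site 2),
      {u ∈ (siteLoopConfig δ ω).loops | (u.range ∩ closedBall (0 : ℂ) R).Nonempty}.ncard ≤ N :=
    ⟨_, fun ω ↦ (ncard_loops_siteLoopConfig_meeting_le hδ R ω).2⟩
  -- every sub-count of the loops meeting the ball is at most `Nmax`
  have hNle : ∀ (ω : SiteConfig (Site 2)) (q : UnbasedLoop ℂ → Prop),
      (∀ u, q u → (u.range ∩ closedBall (0 : ℂ) R).Nonempty) →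
      ((Set.ncard {u ∈ (siteLoopConfig δ ω).loops | q u} : ℝ)) ≤ Nmax := fun ω q hq ↦ by
    rw [Nat.cast_le]
    refine (Set.ncard_le_ncard (fun u hu ↦ ?_) (hT ω)).trans (hNmax ω)
    exact ⟨hu.1, hq u hu.2⟩
  have hN₄le : ∀ (ω : SiteConfig (Site 2)) (x y z w : ℂ),
      |((Set.ncard {u ∈ (siteLoopConfig δ ω).loops | u.wind x ≠ 0 ∧ u.wind y ≠ 0 ∧
        u.wind z ≠ 0 ∧ u.wind w ≠ 0 ∧ (u.range ∩ closedBall (0 : ℂ) R).Nonempty} : ℝ))| ≤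
        Nmax := fun ω x y z w ↦ by
    rw [Nat.abs_cast]
    exact hNle ω (fun u ↦ u.wind x ≠ 0 ∧ u.wind y ≠ 0 ∧ u.wind z ≠ 0 ∧ u.wind w ≠ 0 ∧
      (u.range ∩ closedBall (0 : ℂ) R).Nonempty) fun u hu ↦ hu.2.2.2.2
  have hN₁₃le : ∀ (ω : SiteConfig (Site 2)) (x y z w : ℂ),
      |((Set.ncard {u ∈ (siteLoopConfig δ ω).loops | u.wind x ≠ 0 ∧
        (u.range ∩ closedBall (0 : ℂ) R).Nonempty} : ℝ)) *
        ((Set.ncard {u ∈ (siteLoopConfig δ ω).loops | u.wind y ≠ 0 ∧ u.wind z ≠ 0 ∧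
        u.wind w ≠ 0 ∧ (u.range ∩ closedBall (0 : ℂ) R).Nonempty} : ℝ))| ≤ Nmax * Nmax :=
    fun ω x y z w ↦ by
    rw [abs_mul, Nat.abs_cast, Nat.abs_cast]
    exact mul_le_mul
      (hNle ω (fun u ↦ u.wind x ≠ 0 ∧ (u.range ∩ closedBall (0 : ℂ) R).Nonempty) fun u hu ↦ hu.2)
      (hNle ω (fun u ↦ u.wind y ≠ 0 ∧ u.wind z ≠ 0 ∧ u.wind w ≠ 0 ∧
        (u.range ∩ closedBall (0 : ℂ) R).Nonempty) fun u hu ↦ hu.2.2.2)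
      (Nat.cast_nonneg _) (Nat.cast_nonneg _)
  have hN₂₂le : ∀ (ω : SiteConfig (Site 2)) (x y z w : ℂ),
      |((Set.ncard {u ∈ (siteLoopConfig δ ω).loops | u.wind x ≠ 0 ∧ u.wind y ≠ 0 ∧
        (u.range ∩ closedBall (0 : ℂ) R).Nonempty} : ℝ)) *
        ((Set.ncard {u ∈ (siteLoopConfig δ ω).loops | u.wind z ≠ 0 ∧ u.wind w ≠ 0 ∧
        (u.range ∩ closedBall (0 : ℂ) R).Nonempty} : ℝ))| ≤ Nmax * Nmax :=
    fun ω x y z w ↦ by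
    rw [abs_mul, Nat.abs_cast, Nat.abs_cast]
    exact mul_le_mul
      (hNle ω (fun u ↦ u.wind x ≠ 0 ∧ u.wind y ≠ 0 ∧ (u.range ∩ closedBall (0 : ℂ) R).Nonempty)
        fun u hu ↦ hu.2.2)
      (hNle ω (fun u ↦ u.wind z ≠ 0 ∧ u.wind w ≠ 0 ∧ (u.range ∩ closedBall (0 : ℂ) R).Nonempty)
        fun u hu ↦ hu.2.2)
      (Nat.cast_nonneg _) (Nat.cast_nonneg _)
  -- joint measurability of the counts
  have hwm : ∀ u : UnbasedLoop ℂ, Measurable fun z ↦ u.wind z ≠ 0 := fun u ↦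
    measurableSet_setOf.1 (measurableSet_setOf_wind_ne_zero u)
  have hcast : Measurable fun n : ℕ ↦ (n : ℝ) := measurable_from_nat
  have hmN₄ : Measurable fun r : (((SiteConfig (Site 2) × ℂ) × ℂ) × ℂ) × ℂ ↦
      ((Set.ncard {u ∈ (siteLoopConfig δ r.1.1.1.1).loops | u.wind r.1.1.1.2 ≠ 0 ∧
        u.wind r.1.1.2 ≠ 0 ∧ u.wind r.1.2 ≠ 0 ∧ u.wind r.2 ≠ 0 ∧
        (u.range ∩ closedBall (0 : ℂ) R).Nonempty} : ℝ)) :=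
    hcast.comp (cr_measurable_ncard_loops hδ R measurable_fst.fst.fst.fst
      (Q := fun r u ↦ u.wind r.1.1.1.2 ≠ 0 ∧ u.wind r.1.1.2 ≠ 0 ∧ u.wind r.1.2 ≠ 0 ∧
        u.wind r.2 ≠ 0 ∧ (u.range ∩ closedBall (0 : ℂ) R).Nonempty)
      (fun u ↦ ((hwm u).comp measurable_fst.fst.fst.snd).and
        (((hwm u).comp measurable_fst.fst.snd).and (((hwm u).comp measurable_fst.snd).and
          (((hwm u).comp measurable_snd).and measurable_const))))
      fun _ _ hu ↦ hu.2.2.2.2)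
  have hmX : Measurable fun r : (((SiteConfig (Site 2) × ℂ) × ℂ) × ℂ) × ℂ ↦
      ((Set.ncard {u ∈ (siteLoopConfig δ r.1.1.1.1).loops | u.wind r.1.1.1.2 ≠ 0 ∧
        (u.range ∩ closedBall (0 : ℂ) R).Nonempty} : ℝ)) :=
    hcast.comp (cr_measurable_ncard_loops hδ R measurable_fst.fst.fst.fst
      (Q := fun r u ↦ u.wind r.1.1.1.2 ≠ 0 ∧ (u.range ∩ closedBall (0 : ℂ) R).Nonempty)
      (fun u ↦ ((hwm u).comp measurable_fst.fst.fst.snd).and measurable_const)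
      fun _ _ hu ↦ hu.2)
  have hmYZW : Measurable fun r : (((SiteConfig (Site 2) × ℂ) × ℂ) × ℂ) × ℂ ↦
      ((Set.ncard {u ∈ (siteLoopConfig δ r.1.1.1.1).loops | u.wind r.1.1.2 ≠ 0 ∧
        u.wind r.1.2 ≠ 0 ∧ u.wind r.2 ≠ 0 ∧
        (u.range ∩ closedBall (0 : ℂ) R).Nonempty} : ℝ)) :=
    hcast.comp (cr_measurable_ncard_loops hδ R measurable_fst.fst.fst.fst
      (Q := fun r u ↦ u.wind r.1.1.2 ≠ 0 ∧ u.wind r.1.2 ≠ 0 ∧ u.wind r.2 ≠ 0 ∧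
        (u.range ∩ closedBall (0 : ℂ) R).Nonempty)
      (fun u ↦ ((hwm u).comp measurable_fst.fst.snd).and (((hwm u).comp measurable_fst.snd).and
        (((hwm u).comp measurable_snd).and measurable_const)))
      fun _ _ hu ↦ hu.2.2.2)
  have hmXY : Measurable fun r : (((SiteConfig (Site 2) × ℂ) × ℂ) × ℂ) × ℂ ↦
      ((Set.ncard {u ∈ (siteLoopConfig δ r.1.1.1.1).loops | u.wind r.1.1.1.2 ≠ 0 ∧
        u.wind r.1.1.2 ≠ 0 ∧ (u.range ∩ closedBall (0 : ℂ) R).Nonempty} : ℝ)) :=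
    hcast.comp (cr_measurable_ncard_loops hδ R measurable_fst.fst.fst.fst
      (Q := fun r u ↦ u.wind r.1.1.1.2 ≠ 0 ∧ u.wind r.1.1.2 ≠ 0 ∧
        (u.range ∩ closedBall (0 : ℂ) R).Nonempty)
      (fun u ↦ ((hwm u).comp measurable_fst.fst.fst.snd).and
        (((hwm u).comp measurable_fst.fst.snd).and measurable_const))
      fun _ _ hu ↦ hu.2.2)
  have hmZW : Measurable fun r : (((SiteConfig (Site 2) × ℂ) × ℂ) × ℂ) × ℂ ↦
      ((Set.ncard {u ∈ (siteLoopConfig δ r.1.1.1.1).loops | u.wind r.1.2 ≠ 0 ∧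
        u.wind r.2 ≠ 0 ∧ (u.range ∩ closedBall (0 : ℂ) R).Nonempty} : ℝ)) :=
    hcast.comp (cr_measurable_ncard_loops hδ R measurable_fst.fst.fst.fst
      (Q := fun r u ↦ u.wind r.1.2 ≠ 0 ∧ u.wind r.2 ≠ 0 ∧
        (u.range ∩ closedBall (0 : ℂ) R).Nonempty)
      (fun u ↦ ((hwm u).comp measurable_fst.snd).and
        (((hwm u).comp measurable_snd).and measurable_const))
      fun _ _ hu ↦ hu.2.2)
  refine ⟨?_, ?_, ?_⟩
  · calc ∫ ω, (∑ᶠ u ∈ (siteLoopConfig δ ω).loops, u.nestingPhase f ^ 4)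
          ∂(triSitePercolation half)
        = ∫ ω, (∫ x, ∫ y, ∫ z, ∫ w, f x * f y * f z * f w *
            (Set.ncard {u ∈ (siteLoopConfig δ ω).loops | u.wind x ≠ 0 ∧ u.wind y ≠ 0 ∧
              u.wind z ≠ 0 ∧ u.wind w ≠ 0 ∧ (u.range ∩ closedBall (0 : ℂ) R).Nonempty} : ℝ))
            ∂(triSitePercolation half) :=
          integral_congr_ae (Eventually.of_forall fun ω ↦ (cr4a_pathwise hf hC hR h0 (hT ω)).1)
      _ = _ := cr4b_integral_swap (triSitePercolation half) hfi hf hN₄le hmN₄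
  · calc ∫ ω, (∑ᶠ u ∈ (siteLoopConfig δ ω).loops, u.nestingPhase f) *
          (∑ᶠ u ∈ (siteLoopConfig δ ω).loops, u.nestingPhase f ^ 3) ∂(triSitePercolation half)
        = ∫ ω, (∫ x, ∫ y, ∫ z, ∫ w, f x * f y * f z * f w *
            ((Set.ncard {u ∈ (siteLoopConfig δ ω).loops | u.wind x ≠ 0 ∧
              (u.range ∩ closedBall (0 : ℂ) R).Nonempty} : ℝ) *
            (Set.ncard {u ∈ (siteLoopConfig δ ω).loops | u.wind y ≠ 0 ∧ u.wind z ≠ 0 ∧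
              u.wind w ≠ 0 ∧ (u.range ∩ closedBall (0 : ℂ) R).Nonempty} : ℝ)))
            ∂(triSitePercolation half) :=
          integral_congr_ae (Eventually.of_forall fun ω ↦
            (cr4a_pathwise hf hC hR h0 (hT ω)).2.1)
      _ = _ := cr4b_integral_swap (triSitePercolation half) hfi hf hN₁₃le (hmX.mul hmYZW)
  · calc ∫ ω, (∑ᶠ u ∈ (siteLoopConfig δ ω).loops, u.nestingPhase f ^ 2) ^ 2
          ∂(triSitePercolation half)
        = ∫ ω, (∫ x, ∫ y, ∫ z, ∫ w, f x * f y * f z * f w *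
            ((Set.ncard {u ∈ (siteLoopConfig δ ω).loops | u.wind x ≠ 0 ∧ u.wind y ≠ 0 ∧
              (u.range ∩ closedBall (0 : ℂ) R).Nonempty} : ℝ) *
            (Set.ncard {u ∈ (siteLoopConfig δ ω).loops | u.wind z ≠ 0 ∧ u.wind w ≠ 0 ∧
              (u.range ∩ closedBall (0 : ℂ) R).Nonempty} : ℝ)))
            ∂(triSitePercolation half) :=
          integral_congr_ae (Eventually.of_forall fun ω ↦
            (cr4a_pathwise hf hC hR h0 (hT ω)).2.2)
      _ = _ := cr4b_integral_swap (triSitePercolation half) hfi hf hN₂₂le (hmXY.mul hmZW)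

end Summit.CriticalPhenomena.CardyFormulaZ2.Cruxes.MagicFormulaT.LineSketch

end
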